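/-
Copyright (c) 2026 the pub-hodgecm-mathlib formalisation cell (harness21).  Prover seat hodgecm-mathlib-K2E1-p12 (g6), Track B ∕ K2-LIT, h413 = `stmt-HodgeConjecture-24833`,
R90-TF section S8 «ContSpec-n½», ESTATE T, S8 dealer R90-CS-plan (g3) deal S8-R221 (3): (R)′'s `hEXP` τ-ROW CLOSED — ★ p864446 (K2E1-p11) instantiated with ★ p864481 (K2E1-p15's K-finite
exports head with both τ-ports) through ★ §5 (pure-type splitting) ∕ ★ §6 (additivity) ∕ ★ FILE A (pure-block port binders): every visible letter is discharged except the co-weight line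
at the archimedean group of record (`hCO`, the (α)-instantiation) and the auxiliary Haar frame of the ports.
-/
import Summits.HodgeConjecture.HodgeConjecture.Theorems.R90S8ResGMidPureBlockPortBindersU3                    -- ★ (this seat) FILE A: `exists_isotypy_of_kMax_irreducible`, `exists_archBorelLaw`, `exists_GLlevel_of_isTauLevel`, `hVU_of_le_tauLevel`; brings ★ §5 p864443
import Summits.HodgeConjecture.HodgeConjecture.Theorems.R90S8ResGMidExportsRowAdditiveU3                      -- ★ p864499 (this seat) §6: `exportsTauRow_of_pureBlocks`
import Summits.HodgeConjecture.HodgeConjecture.Theorems.R90S8ResGMidRowsOfTauExportsU3                         -- ★ p864446 (K2E1-p11): `hEXP_tauRow_of_exportsRow`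
import Summits.HodgeConjecture.HodgeConjecture.Theorems.K2E1ChiEisensteinMeromorphicExportsKFiniteOfPortsCMThree  -- ★ p864481 (K2E1-p15): `chiEisenstein_meromorphic_exports_kfinite_of_ports_of_coweightLine`
import Summits.HodgeConjecture.HodgeConjecture.Theorems.R90S8ResGMidAtomAdmissibleOfDensityU3                  -- ★ (R90-C133-p02): `norm_eta_apply_eq_one`, `norm_psi_apply_eq_one` (⇒ `isUnitary_blockChar`, `hSUM_of_unitary` discharged from `hμu`)
import HarnessLib

/-!
# R90-TF · S8 «ContSpec-n½» — `R90S8ResGMidRowsOfTauExportsClosedU3`: (R)′'s `hEXP` τ-ROW WITH EVERY SECTION-SIDE LETTER DISCHARGED — modulo the CO-WEIGHT LINE AT `K_∞` (α) and the ports'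
# auxiliary Haar frame

Cell `hodgecm-mathlib`, crux H413 (`stmt-HodgeConjecture-24833`, lane `--supports … --as helper`), route of record `HCCMUnconditional`; R90-TF section S8, sub-socket (R)′
`sock_S8_res_midBlock_le_residual` (B ED. 7 :337) via ★ p864188 `res_midBlock_le_residual_of_tauAdmissible`, row `hEXP` ((E4) + (E2-bd) for every τ-admissible generator datum).
THEOREMS ONLY (no `def`, no `instance`, no `notation`, no named-fact hypothesis, no `sorry`; default heartbeats); count-neutral; CLOSES NO SOCKET (OF-RECORD composition).

THE CHAIN (all ★): `hEXP := hEXP_tauRow_of_exportsRow L μ hTEXP` (p864446) ← `hTEXP := exportsTauRow_of_pureBlocks L ξ μω hχ₁u hχ₂u hsum hPURE` (§6 p864499; `hχ₁u hχ₂u hsum` from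
`hμu : μω.IsUnitary` by ★ `isUnitary_blockChar`, ★ `norm_eta∕psi_apply_eq_one`, ★ `hSUM_of_unitary`) ← `hPURE` («exports at every section of a ★ §5d pure block») := ★ p864481
`chiEisenstein_meromorphic_exports_kfinite_of_ports_of_coweightLine` with its pure-type binders DISCHARGED by ★ FILE A — `W := ↥W₀`, `τ k := τ₀ ⟨ι k, _⟩`, `hVτ :=
exists_isotypy_of_kMax_irreducible` (internal `W`-isotypy of a `K_max`-irreducible block), `cB, hVB, χM := cB 0, hcBM := exists_archBorelLaw` (archimedean left law of the flat sections of
pair-sections; `z`-free on `M_∞`), `U₀′, hU₀o, hU₀c, hU₀K := exists_GLlevel_of_isTauLevel`, `hVU := hVU_of_le_tauLevel` — and its conclusion PROJECTED to the seven exports clauses.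
* §1 **`hPURE_of_coweightLines (frame) (hCO)`** — the pure-block exports letter of ★ §6, from ★ p864481.
* §2 **`exportsTauRow_closed (hμu) (frame) (hCO)`** — ★ p864446's `hTEXP` ∀-row (exports at EVERY `K_∞`-finite τ-admissible generator).
* §3 **HEAD `hEXP_tauRow_closed (hμu) (frame) (hCO)`** — ★ p864188's `hEXP` binder BYTE FOR BYTE at the `φ_ξ`-block.
* §4 (ED. 2, J-S8-CO) **`hPURE_of_coweightLines'`, `exportsTauRow_closed'`, HEAD `hEXP_tauRow_closed' (hμu) (frame) (hCO′)`** — the same three rows from the letter RESTRICTED to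
  irreducible finite-dimensional `K_∞`-stable `W₀` of CONTINUOUS PAIR-SECTIONS of the block (`hCO′` = `hCO` + binders `hW₀P`, `hW₀c`): the shape J-S8-CO's steps (2)–(5) discharge.
THE RESULTING BINDER LIST OF (R)′'s `hEXP` ROW (S8-R221 (3) «print it»): (F) the socket frame `μ` + the exports' frame `νG ν 𝓕 h𝓕N h𝓕c h𝓕₀ β hβ μZ hμZ` (as in ★ p864188 ∕ ★ p864350);
(F′) THE PORTS' AUXILIARY HAAR FRAME `(μa : Measure G_∞) [IsHaarMeasure] [IsMulRightInvariant]` (two-sided: unimodularity of `U(2,1)(ℝ)^d` is used, not proved) and `(μf : Measure G(𝔸_f)) [IsHaarMeasure]`,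
with `[MeasurableSpace∕BorelSpace]` on `G(𝔸)`, `G_∞`, `G(𝔸_f)`; (U) `hμu : μω.IsUnitary` (Rogawski's auxiliary character is unitary by construction); **(L) `hCO` — THE CO-WEIGHT LINE AT THE
ARCHIMEDEAN GROUP OF RECORD**: for every irreducible finite-dimensional `K_∞`-stable `W₀ ≤ (G(𝔸) → ℂ)` (`τ₀ := r|_{W₀}`), the linear functionals `l : W₀ → ℂ` with
`l(τ₀(m) w) = χ₁(m₀₀)χ₂(m₁₁)·l(w)` for `m ∈ M_∞ = ι⁻¹B(𝔸) ∩ ι⁻¹K` form a LINE — the (α)-instantiation: ★ `R90S8KTypeSliceLineU3` proves it for ONE factor `K_v ↪ U(3)` by Gelfand's trick; the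
product `K_∞ = ∏_{w∣∞} K_w` of a CM field with several complex places needs the componentwise transpose realisation (S–M, flagged, NOT claimed here).  No section-side letter, no gauge letter, no
level letter remains.
HONEST LABEL: HC_CM is proved only modulo the 7 printed citations (2 remaining named inputs: hLiu418 = `stmt-HodgeConjecture-24832`, h413 = `stmt-HodgeConjecture-24833`) until rung 0
closes; this row is OF RECORD modulo (L) + (F′) + (U); (R)′ :337 itself stays `sorry` in B ED. 7 (its other rows `hW1`, hCONT, hSCAT, hSCAL are untouched); REL ≠ ★ ≠ WRITTEN ≠ BUILT; count-neutral.

## References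
* [MoeglinWaldspurger1995] C. Mœglin, J.-L. Waldspurger, *Spectral Decomposition and Eisenstein Series* (1995), II.1.5–II.1.7, IV.1.8–IV.1.11.
* [BernsteinLapid2019] J. Bernstein, E. Lapid, *On the meromorphic continuation of Eisenstein series*, J. Amer. Math. Soc. 37 (2024), Thm 2.3, §4.
* [Knapp1986] A. W. Knapp, *Representation Theory of Semisimple Groups* (1986), VII §1–§2, VIII §3 (Frobenius reciprocity, multiplicity one on `M`).
* [Rogawski1990] J. D. Rogawski, *Automorphic Representations of Unitary Groups in Three Variables* (1990), §12.2, §13.9 (ii).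
-/

set_option autoImplicit false
set_option linter.dupNamespace false  -- the mandated namespace `…HodgeConjecture.HodgeConjecture.R90.S8` (LEAD #1 L1) repeats the summit's segment

noncomputable section

open MeasureTheory Measure Set Filter Topology NumberField IsDedekindDomain ContRepresentation
open Literature.NumberTheory Literature.NumberTheory.Automorphic Literature.NumberTheory.Automorphic.UnitaryGroup Literature.NumberTheory.GaloisRepresentations AdelicGroupData
open Literature.NumberTheory.Automorphic.Arthur2013.Leaves.TECR Literature.NumberTheory.Rogawski1990
open Summit.HodgeConjecture.HodgeConjecture.Cruxes.H413.K2E1BorelEisensteinU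
open Summit.HodgeConjecture.HodgeConjecture.Cruxes.H413.K2E1CharacterEisensteinU2Defs
open Summit.HodgeConjecture.HodgeConjecture.Cruxes.H413.K2E1CharacterEisensteinU3PairDefs
open Summit.HodgeConjecture.HodgeConjecture.Cruxes.H413.K2E1ChiSectionSpaceU3PairDefs
open Summit.HodgeConjecture.HodgeConjecture.Cruxes.H413.K2E1BLBorelSpacesU2Defs Summit.HodgeConjecture.HodgeConjecture.Cruxes.H413.K2E1BLBorelOperatorsU2Defs
open Summit.HodgeConjecture.HodgeConjecture.Cruxes.H413.K2E1ChiEisensteinMeromorphicExportsKFiniteOfPortsCMThree (chiEisenstein_meromorphic_exports_kfinite_of_ports_of_coweightLine)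
open Literature.MeasureTheory.Group
open scoped ENNReal NNReal

namespace Summit.HodgeConjecture.HodgeConjecture.R90.S8

variable (L : Type) [Field L] [NumberField L] [IsCMField L]
  [MeasurableSpace (quasiSplit (↥(maximalRealSubfield L)) L (IsCMField.complexConj L) 3).Adelic] [BorelSpace (quasiSplit (↥(maximalRealSubfield L)) L (IsCMField.complexConj L) 3).Adelic]
  [MeasurableSpace ↥(arch (↥(maximalRealSubfield L)) L (IsCMField.complexConj L) 3 ((StdForm.antidiagonal 3).over L))] [BorelSpace ↥(arch (↥(maximalRealSubfield L)) L (IsCMField.complexConj L) 3 ((StdForm.antidiagonal 3).over L))] [MeasurableSpace ↥(finAdelic (↥(maximalRealSubfield L)) L (IsCMField.complexConj L) 3 ((StdForm.antidiagonal 3).over L))] [BorelSpace ↥(finAdelic (↥(maximalRealSubfield L)) L (IsCMField.complexConj L) 3 ((StdForm.antidiagonal 3).over L))]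
  (μ : Measure (quasiSplit (↥(maximalRealSubfield L)) L (IsCMField.complexConj L) 3).automorphicQuotient) [(quasiSplit (↥(maximalRealSubfield L)) L (IsCMField.complexConj L) 3).IsAutomorphicMeasure μ]
  (νG : Measure (quasiSplit (↥(maximalRealSubfield L)) L (IsCMField.complexConj L) 3).Adelic) [νG.IsHaarMeasure] [νG.IsInvInvariant] [SFinite νG]
  (ν : Measure ↥(adelicUnipotent (↥(maximalRealSubfield L)) L (IsCMField.complexConj L) 3)) [ν.IsHaarMeasure] [ν.IsMulRightInvariant] [ν.IsInvInvariant]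
  {𝓕 : Set ↥(adelicUnipotent (↥(maximalRealSubfield L)) L (IsCMField.complexConj L) 3)}
  (h𝓕N : IsFundamentalDomain ↥(rationalUnipotent (↥(maximalRealSubfield L)) L (IsCMField.complexConj L) 3) 𝓕 ν) (h𝓕c : IsCompact (closure 𝓕)) (h𝓕₀ : ν 𝓕 ≠ 0)
  {β : (quasiSplit (↥(maximalRealSubfield L)) L (IsCMField.complexConj L) 3).Adelic → ℝ≥0∞}
  (hβ : IsCoveringWeight ↥((arithmeticBorel (↥(maximalRealSubfield L)) L (IsCMField.complexConj L) 3).map (quasiSplit (↥(maximalRealSubfield L)) L (IsCMField.complexConj L) 3).arithmeticSubgroup.subtype) β)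
  {μZ : Measure (borelQuotient (↥(maximalRealSubfield L)) L (IsCMField.complexConj L) 3)} [SFinite μZ]
  (hμZ : ∀ f : borelQuotient (↥(maximalRealSubfield L)) L (IsCMField.complexConj L) 3 → ℝ≥0∞, Measurable f → ∫⁻ z, f z ∂μZ = ∫⁻ g, β g * f (toBorelQuotient (↥(maximalRealSubfield L)) L (IsCMField.complexConj L) 3 g) ∂νG)
  (μa : Measure ↥(arch (↥(maximalRealSubfield L)) L (IsCMField.complexConj L) 3 ((StdForm.antidiagonal 3).over L))) [μa.IsHaarMeasure] [μa.IsMulRightInvariant]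
  (μf : Measure ↥(finAdelic (↥(maximalRealSubfield L)) L (IsCMField.complexConj L) 3 ((StdForm.antidiagonal 3).over L))) [μf.IsHaarMeasure]
  (ξ : OneDimAutRepH L) (μω : HeckeCharacter L)

/-! ## §1 The pure-block exports letter `hPURE` of ★ §6 from ★ p864481, all pure-type binders discharged except the co-weight line -/

include μ h𝓕N h𝓕c h𝓕₀ hβ hμZ μa μf in
/-- **§1 — `hPURE_of_coweightLines`**: the PURE-BLOCK EXPORTS LETTER of ★ `exportsTauRow_of_pureBlocks` (exports datum for every section of every ★ §5d pure block), from ★ p864481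
`chiEisenstein_meromorphic_exports_kfinite_of_ports_of_coweightLine` with `hVτ`, `cB`∕`hVB`∕`χM`∕`hcBM`, `U₀′`∕`hVU` supplied by ★ FILE A and `hχ₂ := ξ.hψ`; visible: the frame and the
CO-WEIGHT LINE letter `hCO` (for the character `m ↦ χ₁(m₀₀)χ₂(m₁₁)` of `M_∞`, `(χ₁, χ₂)` the `φ_ξ`-block pair). [cite: BernsteinLapid2019, Thm 2.3, §4] [cite: MoeglinWaldspurger1995, IV.1.8–IV.1.11]
[cite: Knapp1986, VII §1–§2] -/
theorem hPURE_of_coweightLines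
    (hCO : ∀ (W₀ : Submodule ℂ ((quasiSplit (↥(maximalRealSubfield L)) L (IsCMField.complexConj L) 3).Adelic → ℂ)) (hW₀K : ∀ k : ↥(archMaximalCompact L), ∀ ψ ∈ W₀, ((rightTranslation (quasiSplit (↥(maximalRealSubfield L)) L (IsCMField.complexConj L) 3)).comp (archMaximalCompact L).subtype) k ψ ∈ W₀) (_ : FiniteDimensional ℂ ↥W₀) (_ : (Subrepresentation.toRepresentation (⟨W₀, hW₀K⟩ : Subrepresentation ((rightTranslation (quasiSplit (↥(maximalRealSubfield L)) L (IsCMField.complexConj L) 3)).comp (archMaximalCompact L).subtype))).IsIrreducible),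
      ∃ l₀ : ↥W₀ →ₗ[ℂ] ℂ, ∀ l : ↥W₀ →ₗ[ℂ] ℂ,
        (∀ (m : ↥(arch (↥(maximalRealSubfield L)) L (IsCMField.complexConj L) 3 ((StdForm.antidiagonal 3).over L))) (hmB : (archToAdelic (↥(maximalRealSubfield L)) L (IsCMField.complexConj L) 3 ((StdForm.antidiagonal 3).over L)) m ∈ borelAdelic (↥(maximalRealSubfield L)) L (IsCMField.complexConj L) 3) (hmK : (adelicVal (↥(maximalRealSubfield L)) L (IsCMField.complexConj L) 3 ((StdForm.antidiagonal 3).over L)) ((archToAdelic (↥(maximalRealSubfield L)) L (IsCMField.complexConj L) 3 ((StdForm.antidiagonal 3).over L)) m) ∈ standardMaximalCompactGL 3 L) (w : ↥W₀),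
          l ((Subrepresentation.toRepresentation (⟨W₀, hW₀K⟩ : Subrepresentation ((rightTranslation (quasiSplit (↥(maximalRealSubfield L)) L (IsCMField.complexConj L) 3)).comp (archMaximalCompact L).subtype))) ⟨(archToAdelic (↥(maximalRealSubfield L)) L (IsCMField.complexConj L) 3 ((StdForm.antidiagonal 3).over L)) m, archToAdelic_mem_archMaximalCompact L m hmK⟩ w) = ((((ξ.bcη⁻¹ * ξ.bcψ⁻¹ * μω)) (firstEntryUnit hmB) : ℂˣ) : ℂ) * (((ξ.ψ) (middleEntryUnitary hmB) : ℂˣ) : ℂ) * l w) →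
        ∃ a : ℂ, l = a • l₀) :
    ∀ (U₀ : Subgroup ↥(finAdelic (↥(maximalRealSubfield L)) L (IsCMField.complexConj L) 3 ((StdForm.antidiagonal 3).over L))) (_ : IsTauLevel L U₀) (V : Submodule ℂ ((quasiSplit (↥(maximalRealSubfield L)) L (IsCMField.complexConj L) 3).Adelic → ℂ)) (_ : FiniteDimensional ℂ ↥V)
      (_ : ∀ k ∈ ((standardMaximalCompactGL 3 L).comap (adelicVal (↥(maximalRealSubfield L)) L (IsCMField.complexConj L) 3 ((StdForm.antidiagonal 3).over L)) : Subgroup (quasiSplit (↥(maximalRealSubfield L)) L (IsCMField.complexConj L) 3).Adelic), ∀ ψ ∈ V, (fun x => ψ (x * k)) ∈ V) (_ : ∀ ψ ∈ V, IsChiSectionPair (ξ.bcη⁻¹ * ξ.bcψ⁻¹ * μω) ξ.ψ ψ) (_ : ∀ ψ ∈ V, Continuous ψ)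
      (_ : ∀ ψ ∈ V, ∃ M : ℝ, ∀ x, ‖ψ x‖ ≤ M) (_ : V ≤ chiSectionSpacePair (ξ.bcη⁻¹ * ξ.bcψ⁻¹ * μω) ξ.ψ (tauLevel L U₀) ((1 : ↥(tauLevel L U₀) →* ℂ) : ↥(tauLevel L U₀) → ℂ))
      (_ : ∃ hV : ∀ k : ↥((standardMaximalCompactGL 3 L).comap (adelicVal (↥(maximalRealSubfield L)) L (IsCMField.complexConj L) 3 ((StdForm.antidiagonal 3).over L)) : Subgroup (quasiSplit (↥(maximalRealSubfield L)) L (IsCMField.complexConj L) 3).Adelic), ∀ ψ ∈ V, ((rightTranslation (quasiSplit (↥(maximalRealSubfield L)) L (IsCMField.complexConj L) 3)).comp ((standardMaximalCompactGL 3 L).comap (adelicVal (↥(maximalRealSubfield L)) L (IsCMField.complexConj L) 3 ((StdForm.antidiagonal 3).over L)) : Subgroup (quasiSplit (↥(maximalRealSubfield L)) L (IsCMField.complexConj L) 3).Adelic).subtype) k ψ ∈ V, (Subrepresentation.toRepresentation (⟨V, hV⟩ : Subrepresentation ((rightTranslation (quasiSplit (↥(maximalRealSubfield L)) L (IsCMField.complexConj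 L) 3)).comp ((standardMaximalCompactGL 3 L).comap (adelicVal (↥(maximalRealSubfield L)) L (IsCMField.complexConj L) 3 ((StdForm.antidiagonal 3).over L)) : Subgroup (quasiSplit (↥(maximalRealSubfield L)) L (IsCMField.complexConj L) 3).Adelic).subtype))).IsIrreducible)
      (_ : ∃ (W₀ : Submodule ℂ ((quasiSplit (↥(maximalRealSubfield L)) L (IsCMField.complexConj L) 3).Adelic → ℂ)) (hW₀K : ∀ k : ↥(archMaximalCompact L), ∀ ψ ∈ W₀, ((rightTranslation (quasiSplit (↥(maximalRealSubfield L)) L (IsCMField.complexConj L) 3)).comp (archMaximalCompact L).subtype) k ψ ∈ W₀),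
        FiniteDimensional ℂ ↥W₀ ∧ (Subrepresentation.toRepresentation (⟨W₀, hW₀K⟩ : Subrepresentation ((rightTranslation (quasiSplit (↥(maximalRealSubfield L)) L (IsCMField.complexConj L) 3)).comp (archMaximalCompact L).subtype))).IsIrreducible ∧
        V ≤ chiSectionSpacePairKType (ξ.bcη⁻¹ * ξ.bcψ⁻¹ * μω) ξ.ψ (tauLevel L U₀) ((1 : ↥(tauLevel L U₀) →* ℂ) : ↥(tauLevel L U₀) → ℂ) (archMaximalCompact L).subtype (commute_tauLevel_archMaximalCompact L U₀) (Subrepresentation.toRepresentation (⟨W₀, hW₀K⟩ : Subrepresentation ((rightTranslation (quasiSplit (↥(maximalRealSubfield L)) L (IsCMField.complexConj L) 3)).comp (archMaximalCompact L).subtype)))),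
      ∀ φ ∈ V, ∃ (Ec' : ℂ → (quasiSplit (↥(maximalRealSubfield L)) L (IsCMField.complexConj L) 3).Adelic → ℂ) (P : Set ℂ), IsClosed P ∧ (∀ z₀ : ℂ, ∀ᶠ s in 𝓝[≠] z₀, s ∉ P) ∧ (∀ z ∈ P, z.re ≤ 2) ∧
        (∀ z : ℂ, 2 < z.re → Ec' z = eisensteinSeriesU (flatSectionU φ z)) ∧ (∀ g (z : ℂ), z ∉ P → AnalyticAt ℂ (fun z => Ec' z g) z) ∧
        (∀ z : ℂ, z ∉ P → Continuous (Ec' z)) ∧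
        (∀ z₁ : ℂ, z₁ ∉ P → ∀ K : Set (quasiSplit (↥(maximalRealSubfield L)) L (IsCMField.complexConj L) 3).Adelic, IsCompact K → ∃ V ∈ 𝓝 z₁, ∃ M : ℝ, ∀ z ∈ V, ∀ g ∈ K, ‖Ec' z g‖ ≤ M) := by
  classical
  intro U₀ hU₀ V hVfd hVK hVχ hVc hVM hVlev hVirr _ φ hφ
  haveI := hVfd
  obtain ⟨hV, hirrV⟩ := hVirr
  -- the internal `W`-isotypy of the `K_max`-irreducible block (★ FILE A §A1)
  obtain ⟨W₀, hW₀K, -, hW₀fd, hirr₀, hVτ⟩ := exists_isotypy_of_kMax_irreducible L V hV hirrV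
  haveI := hW₀fd
  -- the archimedean left law (★ FILE A §A2) and the `GL₃(𝔸_f)`-level (★ FILE A §A3)
  obtain ⟨cB, hVB, hcBz, hcB0⟩ := exists_archBorelLaw L (V := V) hVχ
  obtain ⟨U₀', hU₀o, hU₀c, hU₀K, hsub⟩ := exists_GLlevel_of_isTauLevel L hU₀
  have hVU := hVU_of_le_tauLevel L hVlev hsub
  -- the co-weight line for this `τ₀`, in the ports' spelling
  obtain ⟨l₀, hl₀⟩ := hCO W₀ hW₀K hW₀fd hirr₀
  have hco : ∃ l₀ : ↥W₀ →ₗ[ℂ] ℂ, ∀ l : ↥W₀ →ₗ[ℂ] ℂ,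
      (∀ m ∈ (borelAdelic (↥(maximalRealSubfield L)) L (IsCMField.complexConj L) 3).comap (archToAdelic (↥(maximalRealSubfield L)) L (IsCMField.complexConj L) 3 ((StdForm.antidiagonal 3).over L)), m ∈ (((standardMaximalCompactGL 3 L).comap (adelicVal (↥(maximalRealSubfield L)) L (IsCMField.complexConj L) 3 ((StdForm.antidiagonal 3).over L)) : Subgroup (quasiSplit (↥(maximalRealSubfield L)) L (IsCMField.complexConj L) 3).Adelic)).comap (archToAdelic (↥(maximalRealSubfield L)) L (IsCMField.complexConj L) 3 ((StdForm.antidiagonal 3).over L)) →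
        ∀ w, l ((fun a : ↥(arch (↥(maximalRealSubfield L)) L (IsCMField.complexConj L) 3 ((StdForm.antidiagonal 3).over L)) => if h : (adelicVal (↥(maximalRealSubfield L)) L (IsCMField.complexConj L) 3 ((StdForm.antidiagonal 3).over L)) ((archToAdelic (↥(maximalRealSubfield L)) L (IsCMField.complexConj L) 3 ((StdForm.antidiagonal 3).over L)) a) ∈ standardMaximalCompactGL 3 L then (Subrepresentation.toRepresentation (⟨W₀, hW₀K⟩ : Subrepresentation ((rightTranslation (quasiSplit (↥(maximalRealSubfield L)) L (IsCMField.complexConj L) 3)).comp (archMaximalCompact L).subtype))) ⟨(archToAdelic (↥(maximalRealSubfield L)) L (IsCMField.complexConj L) 3 ((StdForm.antidiagonal 3).over L)) a, archToAdelic_mem_archMaximalCompact L a h⟩ else LinearMap.id) m w) = cB 0 m * l w) →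
      ∃ a : ℂ, l = a • l₀ := by
    refine ⟨l₀, fun l hl => hl₀ l fun m hmB hmK w => ?_⟩
    have h := hl m hmB hmK w
    dsimp only at h
    rwa [dif_pos hmK, hcB0 m hmB hmK] at h
  -- the K-finite exports head with both τ-ports, projected to the seven exports clauses
  obtain ⟨n, φ', q, Ec, qc, P, -, -, -, -, -, -, -, -, hE2, -, hPc, hPcd, hPre, hEan, -, -, -, hE4, hEbd⟩ :=
    chiEisenstein_meromorphic_exports_kfinite_of_ports_of_coweightLine L (μ := μ) (νG := νG) (ν := ν) h𝓕N h𝓕c h𝓕₀ hβ hμZ μa μf ξ.hψ V hVK hVχ hVc hVM U₀' hU₀o hU₀c hU₀K hVU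
      (fun a : ↥(arch (↥(maximalRealSubfield L)) L (IsCMField.complexConj L) 3 ((StdForm.antidiagonal 3).over L)) => if h : (adelicVal (↥(maximalRealSubfield L)) L (IsCMField.complexConj L) 3 ((StdForm.antidiagonal 3).over L)) ((archToAdelic (↥(maximalRealSubfield L)) L (IsCMField.complexConj L) 3 ((StdForm.antidiagonal 3).over L)) a) ∈ standardMaximalCompactGL 3 L then (Subrepresentation.toRepresentation (⟨W₀, hW₀K⟩ : Subrepresentation ((rightTranslation (quasiSplit (↥(maximalRealSubfield L)) L (IsCMField.complexConj L) 3)).comp (archMaximalCompact L).subtype))) ⟨(archToAdelic (↥(maximalRealSubfield L)) L (IsCMField.complexConj L) 3 ((StdForm.antidiagonal 3).over L)) a, archToAdelic_mem_archMaximalCompact L a h⟩ else LinearMap.id)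
      cB hVB hVτ (cB 0) hcBz hco hφ
  exact ⟨Ec, P, hPc, hPcd, hPre, hE2, hEan, hE4, hEbd⟩

/-! ## §2 The exports row `hTEXP` at every `K_∞`-finite τ-admissible generator -/

include μ h𝓕N h𝓕c h𝓕₀ hβ hμZ μa μf in
/-- **§2 — `exportsTauRow_closed`**: ★ p864446's `hTEXP` ∀-row — SOME continuation with a closed co-discrete pole set `⊆ {Re ≤ 2}`, the tube identity, analyticity, (E4), (E2-bd), for EVERY
τ-admissible `(U₀, φ)` of the `φ_ξ`-block — from `hμu` (★ `isUnitary_blockChar`, ★ `norm_eta∕psi_apply_eq_one`, ★ `hSUM_of_unitary`), the frame and `hCO` (★ §6 `exportsTauRow_of_pureBlocks` ∘ §1).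
[cite: MoeglinWaldspurger1995, II.1.5, IV.1.9–IV.1.11] [cite: BernsteinLapid2019, Thm 2.3, §4] -/
theorem exportsTauRow_closed (hμu : μω.IsUnitary)
    (hCO : ∀ (W₀ : Submodule ℂ ((quasiSplit (↥(maximalRealSubfield L)) L (IsCMField.complexConj L) 3).Adelic → ℂ)) (hW₀K : ∀ k : ↥(archMaximalCompact L), ∀ ψ ∈ W₀, ((rightTranslation (quasiSplit (↥(maximalRealSubfield L)) L (IsCMField.complexConj L) 3)).comp (archMaximalCompact L).subtype) k ψ ∈ W₀) (_ : FiniteDimensional ℂ ↥W₀) (_ : (Subrepresentation.toRepresentation (⟨W₀, hW₀K⟩ : Subrepresentation ((rightTranslation (quasiSplit (↥(maximalRealSubfield L)) L (IsCMField.complexConj L) 3)).comp (archMaximalCompact L).subtype))).IsIrreducible),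
      ∃ l₀ : ↥W₀ →ₗ[ℂ] ℂ, ∀ l : ↥W₀ →ₗ[ℂ] ℂ,
        (∀ (m : ↥(arch (↥(maximalRealSubfield L)) L (IsCMField.complexConj L) 3 ((StdForm.antidiagonal 3).over L))) (hmB : (archToAdelic (↥(maximalRealSubfield L)) L (IsCMField.complexConj L) 3 ((StdForm.antidiagonal 3).over L)) m ∈ borelAdelic (↥(maximalRealSubfield L)) L (IsCMField.complexConj L) 3) (hmK : (adelicVal (↥(maximalRealSubfield L)) L (IsCMField.complexConj L) 3 ((StdForm.antidiagonal 3).over L)) ((archToAdelic (↥(maximalRealSubfield L)) L (IsCMField.complexConj L) 3 ((StdForm.antidiagonal 3).over L)) m) ∈ standardMaximalCompactGL 3 L) (w : ↥W₀),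
          l ((Subrepresentation.toRepresentation (⟨W₀, hW₀K⟩ : Subrepresentation ((rightTranslation (quasiSplit (↥(maximalRealSubfield L)) L (IsCMField.complexConj L) 3)).comp (archMaximalCompact L).subtype))) ⟨(archToAdelic (↥(maximalRealSubfield L)) L (IsCMField.complexConj L) 3 ((StdForm.antidiagonal 3).over L)) m, archToAdelic_mem_archMaximalCompact L m hmK⟩ w) = ((((ξ.bcη⁻¹ * ξ.bcψ⁻¹ * μω)) (firstEntryUnit hmB) : ℂˣ) : ℂ) * (((ξ.ψ) (middleEntryUnitary hmB) : ℂˣ) : ℂ) * l w) →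
        ∃ a : ℂ, l = a • l₀) :
    ∀ (U₀ : Subgroup ↥(finAdelic (↥(maximalRealSubfield L)) L (IsCMField.complexConj L) 3 ((StdForm.antidiagonal 3).over L))) (_ : IsTauLevel L U₀) (φ : (quasiSplit (↥(maximalRealSubfield L)) L (IsCMField.complexConj L) 3).Adelic → ℂ) (_ : φ ∈ chiSectionSpacePair (ξ.bcη⁻¹ * ξ.bcψ⁻¹ * μω) ξ.ψ (tauLevel L U₀) ((1 : ↥(tauLevel L U₀) →* ℂ) : ↥(tauLevel L U₀) → ℂ)) (_ : Continuous φ) (_ : IsArchFinite L φ),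
      ∃ (Ec' : ℂ → (quasiSplit (↥(maximalRealSubfield L)) L (IsCMField.complexConj L) 3).Adelic → ℂ) (P : Set ℂ), IsClosed P ∧ (∀ z₀ : ℂ, ∀ᶠ s in 𝓝[≠] z₀, s ∉ P) ∧ (∀ z ∈ P, z.re ≤ 2) ∧
        (∀ z : ℂ, 2 < z.re → Ec' z = eisensteinSeriesU (flatSectionU φ z)) ∧ (∀ g (z : ℂ), z ∉ P → AnalyticAt ℂ (fun z => Ec' z g) z) ∧
        (∀ z : ℂ, z ∉ P → Continuous (Ec' z)) ∧
        (∀ z₁ : ℂ, z₁ ∉ P → ∀ K : Set (quasiSplit (↥(maximalRealSubfield L)) L (IsCMField.complexConj L) 3).Adelic, IsCompact K → ∃ V ∈ 𝓝 z₁, ∃ M : ℝ, ∀ z ∈ V, ∀ g ∈ K, ‖Ec' z g‖ ≤ M) :=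
  exportsTauRow_of_pureBlocks L ξ μω (isUnitary_blockChar L ξ μω hμu (norm_eta_apply_eq_one L ξ) (norm_psi_apply_eq_one L ξ)) (norm_psi_apply_eq_one L ξ)
    (hSUM_of_unitary L ξ μω hμu (norm_eta_apply_eq_one L ξ) (norm_psi_apply_eq_one L ξ))
    (hPURE_of_coweightLines L μ νG ν h𝓕N h𝓕c h𝓕₀ hβ hμZ μa μf ξ μω hCO)

/-! ## §3 HEAD: (R)′'s `hEXP` τ-row -/

include μ h𝓕N h𝓕c h𝓕₀ hβ hμZ μa μf in
/-- **§3 HEAD — `hEXP_tauRow_closed`**: the `hEXP` binder of ★ p864188 `res_midBlock_le_residual_of_tauAdmissible` at the `φ_ξ`-block — (E4) «`Ec z` continuous on `G(𝔸)`» and (E2-bd) «joint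
local bound, uniformly on compacts» for the OWN continuation `Ec` of EVERY τ-admissible generator datum `(U₀, φ, Ec, Sp, Fp, f)` on the slit plane `{1 < Re} ∖ Sp` — BYTE FOR BYTE, from
`hμu`, the frame and the co-weight-line letter `hCO` (★ p864446 `hEXP_tauRow_of_exportsRow` ∘ §2).  Binder list of record: see the module docstring ((F), (F′), (U), (L)).
[cite: MoeglinWaldspurger1995, IV.1.9–IV.1.11] [cite: BernsteinLapid2019, Thm 2.3, §4] [cite: Rogawski1990, §13.9 (ii)] -/
theorem hEXP_tauRow_closed (hμu : μω.IsUnitary)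
    (hCO : ∀ (W₀ : Submodule ℂ ((quasiSplit (↥(maximalRealSubfield L)) L (IsCMField.complexConj L) 3).Adelic → ℂ)) (hW₀K : ∀ k : ↥(archMaximalCompact L), ∀ ψ ∈ W₀, ((rightTranslation (quasiSplit (↥(maximalRealSubfield L)) L (IsCMField.complexConj L) 3)).comp (archMaximalCompact L).subtype) k ψ ∈ W₀) (_ : FiniteDimensional ℂ ↥W₀) (_ : (Subrepresentation.toRepresentation (⟨W₀, hW₀K⟩ : Subrepresentation ((rightTranslation (quasiSplit (↥(maximalRealSubfield L)) L (IsCMField.complexConj L) 3)).comp (archMaximalCompact L).subtype))).IsIrreducible),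
      ∃ l₀ : ↥W₀ →ₗ[ℂ] ℂ, ∀ l : ↥W₀ →ₗ[ℂ] ℂ,
        (∀ (m : ↥(arch (↥(maximalRealSubfield L)) L (IsCMField.complexConj L) 3 ((StdForm.antidiagonal 3).over L))) (hmB : (archToAdelic (↥(maximalRealSubfield L)) L (IsCMField.complexConj L) 3 ((StdForm.antidiagonal 3).over L)) m ∈ borelAdelic (↥(maximalRealSubfield L)) L (IsCMField.complexConj L) 3) (hmK : (adelicVal (↥(maximalRealSubfield L)) L (IsCMField.complexConj L) 3 ((StdForm.antidiagonal 3).over L)) ((archToAdelic (↥(maximalRealSubfield L)) L (IsCMField.complexConj L) 3 ((StdForm.antidiagonal 3).over L)) m) ∈ standardMaximalCompactGL 3 L) (w : ↥W₀),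
          l ((Subrepresentation.toRepresentation (⟨W₀, hW₀K⟩ : Subrepresentation ((rightTranslation (quasiSplit (↥(maximalRealSubfield L)) L (IsCMField.complexConj L) 3)).comp (archMaximalCompact L).subtype))) ⟨(archToAdelic (↥(maximalRealSubfield L)) L (IsCMField.complexConj L) 3 ((StdForm.antidiagonal 3).over L)) m, archToAdelic_mem_archMaximalCompact L m hmK⟩ w) = ((((ξ.bcη⁻¹ * ξ.bcψ⁻¹ * μω)) (firstEntryUnit hmB) : ℂˣ) : ℂ) * (((ξ.ψ) (middleEntryUnitary hmB) : ℂˣ) : ℂ) * l w) →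
        ∃ a : ℂ, l = a • l₀) :
    ∀ (U₀ : Subgroup ↥(finAdelic (↥(maximalRealSubfield L)) L (IsCMField.complexConj L) 3 ((StdForm.antidiagonal 3).over L))) (_ : IsTauLevel L U₀)
      (φ : (quasiSplit (↥(maximalRealSubfield L)) L (IsCMField.complexConj L) 3).Adelic → ℂ) (_ : φ ∈ chiSectionSpacePair (ξ.bcη⁻¹ * ξ.bcψ⁻¹ * μω) ξ.ψ (tauLevel L U₀) ((1 : ↥(tauLevel L U₀) →* ℂ) : ↥(tauLevel L U₀) → ℂ)) (_ : Continuous φ)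
      (_ : IsArchFinite L φ)
      (Ec : ℂ → (quasiSplit (↥(maximalRealSubfield L)) L (IsCMField.complexConj L) 3).Adelic → ℂ) (Sp : Finset ℂ) (_ : ∀ s ∈ Sp, s.im = 0 ∧ 1 < s.re ∧ s.re ≤ 2)
      (_ : ∀ g, DifferentiableOn ℂ (fun z => Ec z g) ({z : ℂ | 1 < z.re} \ (↑Sp : Set ℂ)))
      (_ : ∀ z : ℂ, 2 < z.re → Ec z = eisensteinSeriesU (flatSectionU φ z))
      (Fp : (quasiSplit (↥(maximalRealSubfield L)) L (IsCMField.complexConj L) 3).Adelic → ℂ → ℂ) (_ : ∀ g, AnalyticAt ℂ (Fp g) ((3 : ℂ) / 2))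
      (_ : ∀ g, Fp g =ᶠ[𝓝[≠] ((3 : ℂ) / 2)] fun z => (z - (3 : ℂ) / 2) * Ec z g)
      (f : (quasiSplit (↥(maximalRealSubfield L)) L (IsCMField.complexConj L) 3).L2 μ) (_ : (f : (quasiSplit (↥(maximalRealSubfield L)) L (IsCMField.complexConj L) 3).automorphicQuotient → ℂ) =ᵐ[μ] fun x => Fp (Quotient.out (x : (quasiSplit (↥(maximalRealSubfield L)) L (IsCMField.complexConj L) 3).Adelic ⧸ (quasiSplit (↥(maximalRealSubfield L)) L (IsCMField.complexConj L) 3).quotientSubgroup))⁻¹ ((3 : ℂ) / 2)), (∀ z ∈ ({z : ℂ | 1 < z.re} \ (↑Sp : Set ℂ)), Continuous (Ec z)) ∧ (∀ z₁ ∈ ({z : ℂ | 1 < z.re} \ (↑Sp : Set ℂ)), ∀ K : Set (quasiSplit (↥(maximalRealSubfield L)) L (IsCMField.complexConj L) 3).Adelic, IsCompact K → ∃ V ∈ 𝓝 z₁, ∃ M : ℝ, ∀ z ∈ V, ∀ g ∈ K, ‖Ec z g‖ ≤ M)  :=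
  hEXP_tauRow_of_exportsRow L μ (exportsTauRow_closed L μ νG ν h𝓕N h𝓕c h𝓕₀ hβ hμZ μa μf ξ μω hμu hCO)


/-! ## §4 ED. 2 (J-S8-CO): the same three rows from the co-weight line letter RESTRICTED TO BLOCKS OF CONTINUOUS PAIR-SECTIONS (`hCO′`)

The letter `hCO` of §1–§3 quantifies over EVERY irreducible finite-dimensional `K_∞`-stable `W₀ ≤ (G(𝔸) → ℂ)`.  Its discharge (J-S8-CO, steps (2)–(5): ★ `R90S8CoweightLineOfHomSpaceLineU3`
(Riesz bridge), `R90S8ArchMaximalCompactTransposeRealisationU3` (product transpose realisation of `K_∞`, Gelfand's trick at `(K_∞, M_∞)`), `R90S8KFiniteBlockHilbertPackagingU3` (Hilbert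
packaging of `W₀`), `R90S8KTypeCoweightLineProductU3` (assembly)) needs `W₀` to consist of CONTINUOUS PAIR-SECTIONS of the block (strong continuity of `k ↦ r(k)w`; definiteness of the
`∫_{K_max}` form by the pair law).  §1 applies the letter only to the `W₀ ≤ V` of ★ `exists_isotypy_of_kMax_irreducible` inside a ★ §5d block `V` (`hVχ`, `hVc`), so the restricted letter
**`hCO′` := `hCO` with the two extra binders `(hW₀P : ∀ ψ ∈ W₀, IsChiSectionPair χ₁ χ₂ ψ) (hW₀c : ∀ ψ ∈ W₀, Continuous ψ)`** gives the same three rows verbatim. -/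

include μ h𝓕N h𝓕c h𝓕₀ hβ hμZ μa μf in
/-- **§4.1 — `hPURE_of_coweightLines'`** (ED. 2 of §1): the pure-block exports letter from the RESTRICTED co-weight line letter `hCO′` (co-weight line only for irreducible finite-dimensional
`K_∞`-stable `W₀` made of CONTINUOUS PAIR-SECTIONS of the `φ_ξ`-block); same proof as §1, the two new binders fed by `W₀ ≤ V`, `hVχ`, `hVc`. [cite: BernsteinLapid2019, Thm 2.3, §4]
[cite: MoeglinWaldspurger1995, IV.1.8–IV.1.11] [cite: Knapp1986, VII §1–§2] -/
theorem hPURE_of_coweightLines'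
    (hCO : ∀ (W₀ : Submodule ℂ ((quasiSplit (↥(maximalRealSubfield L)) L (IsCMField.complexConj L) 3).Adelic → ℂ)) (hW₀K : ∀ k : ↥(archMaximalCompact L), ∀ ψ ∈ W₀, ((rightTranslation (quasiSplit (↥(maximalRealSubfield L)) L (IsCMField.complexConj L) 3)).comp (archMaximalCompact L).subtype) k ψ ∈ W₀) (_ : FiniteDimensional ℂ ↥W₀)
      (_ : ∀ ψ ∈ W₀, IsChiSectionPair (ξ.bcη⁻¹ * ξ.bcψ⁻¹ * μω) ξ.ψ ψ) (_ : ∀ ψ ∈ W₀, Continuous ψ) (_ : (Subrepresentation.toRepresentation (⟨W₀, hW₀K⟩ : Subrepresentation ((rightTranslation (quasiSplit (↥(maximalRealSubfield L)) L (IsCMField.complexConj L) 3)).comp (archMaximalCompact L).subtype))).IsIrreducible),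
      ∃ l₀ : ↥W₀ →ₗ[ℂ] ℂ, ∀ l : ↥W₀ →ₗ[ℂ] ℂ,
        (∀ (m : ↥(arch (↥(maximalRealSubfield L)) L (IsCMField.complexConj L) 3 ((StdForm.antidiagonal 3).over L))) (hmB : (archToAdelic (↥(maximalRealSubfield L)) L (IsCMField.complexConj L) 3 ((StdForm.antidiagonal 3).over L)) m ∈ borelAdelic (↥(maximalRealSubfield L)) L (IsCMField.complexConj L) 3) (hmK : (adelicVal (↥(maximalRealSubfield L)) L (IsCMField.complexConj L) 3 ((StdForm.antidiagonal 3).over L)) ((archToAdelic (↥(maximalRealSubfield L)) L (IsCMField.complexConj L) 3 ((StdForm.antidiagonal 3).over L)) m) ∈ standardMaximalCompactGL 3 L) (w : ↥W₀),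
          l ((Subrepresentation.toRepresentation (⟨W₀, hW₀K⟩ : Subrepresentation ((rightTranslation (quasiSplit (↥(maximalRealSubfield L)) L (IsCMField.complexConj L) 3)).comp (archMaximalCompact L).subtype))) ⟨(archToAdelic (↥(maximalRealSubfield L)) L (IsCMField.complexConj L) 3 ((StdForm.antidiagonal 3).over L)) m, archToAdelic_mem_archMaximalCompact L m hmK⟩ w) = ((((ξ.bcη⁻¹ * ξ.bcψ⁻¹ * μω)) (firstEntryUnit hmB) : ℂˣ) : ℂ) * (((ξ.ψ) (middleEntryUnitary hmB) : ℂˣ) : ℂ) * l w) →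
        ∃ a : ℂ, l = a • l₀) :
    ∀ (U₀ : Subgroup ↥(finAdelic (↥(maximalRealSubfield L)) L (IsCMField.complexConj L) 3 ((StdForm.antidiagonal 3).over L))) (_ : IsTauLevel L U₀) (V : Submodule ℂ ((quasiSplit (↥(maximalRealSubfield L)) L (IsCMField.complexConj L) 3).Adelic → ℂ)) (_ : FiniteDimensional ℂ ↥V)
      (_ : ∀ k ∈ ((standardMaximalCompactGL 3 L).comap (adelicVal (↥(maximalRealSubfield L)) L (IsCMField.complexConj L) 3 ((StdForm.antidiagonal 3).over L)) : Subgroup (quasiSplit (↥(maximalRealSubfield L)) L (IsCMField.complexConj L) 3).Adelic), ∀ ψ ∈ V, (fun x => ψ (x * k)) ∈ V) (_ : ∀ ψ ∈ V, IsChiSectionPair (ξ.bcη⁻¹ * ξ.bcψ⁻¹ * μω) ξ.ψ ψ) (_ : ∀ ψ ∈ V, Continuous ψ)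
      (_ : ∀ ψ ∈ V, ∃ M : ℝ, ∀ x, ‖ψ x‖ ≤ M) (_ : V ≤ chiSectionSpacePair (ξ.bcη⁻¹ * ξ.bcψ⁻¹ * μω) ξ.ψ (tauLevel L U₀) ((1 : ↥(tauLevel L U₀) →* ℂ) : ↥(tauLevel L U₀) → ℂ))
      (_ : ∃ hV : ∀ k : ↥((standardMaximalCompactGL 3 L).comap (adelicVal (↥(maximalRealSubfield L)) L (IsCMField.complexConj L) 3 ((StdForm.antidiagonal 3).over L)) : Subgroup (quasiSplit (↥(maximalRealSubfield L)) L (IsCMField.complexConj L) 3).Adelic), ∀ ψ ∈ V, ((rightTranslation (quasiSplit (↥(maximalRealSubfield L)) L (IsCMField.complexConj L) 3)).comp ((standardMaximalCompactGL 3 L).comap (adelicVal (↥(maximalRealSubfield L)) L (IsCMField.complexConj L) 3 ((StdForm.antidiagonal 3).over L)) : Subgroup (quasiSplit (↥(maximalRealSubfield L)) L (IsCMField.complexConj L) 3).Adelic).subtype) k ψ ∈ V, (Subrepresentation.toRepresentation (⟨V, hV⟩ : Subrepresentation ((rightTranslation (quasiSplit (↥(maximalRealSubfield L)) L (IsCMField.complexConj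 L) 3)).comp ((standardMaximalCompactGL 3 L).comap (adelicVal (↥(maximalRealSubfield L)) L (IsCMField.complexConj L) 3 ((StdForm.antidiagonal 3).over L)) : Subgroup (quasiSplit (↥(maximalRealSubfield L)) L (IsCMField.complexConj L) 3).Adelic).subtype))).IsIrreducible)
      (_ : ∃ (W₀ : Submodule ℂ ((quasiSplit (↥(maximalRealSubfield L)) L (IsCMField.complexConj L) 3).Adelic → ℂ)) (hW₀K : ∀ k : ↥(archMaximalCompact L), ∀ ψ ∈ W₀, ((rightTranslation (quasiSplit (↥(maximalRealSubfield L)) L (IsCMField.complexConj L) 3)).comp (archMaximalCompact L).subtype) k ψ ∈ W₀),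
        FiniteDimensional ℂ ↥W₀ ∧ (Subrepresentation.toRepresentation (⟨W₀, hW₀K⟩ : Subrepresentation ((rightTranslation (quasiSplit (↥(maximalRealSubfield L)) L (IsCMField.complexConj L) 3)).comp (archMaximalCompact L).subtype))).IsIrreducible ∧
        V ≤ chiSectionSpacePairKType (ξ.bcη⁻¹ * ξ.bcψ⁻¹ * μω) ξ.ψ (tauLevel L U₀) ((1 : ↥(tauLevel L U₀) →* ℂ) : ↥(tauLevel L U₀) → ℂ) (archMaximalCompact L).subtype (commute_tauLevel_archMaximalCompact L U₀) (Subrepresentation.toRepresentation (⟨W₀, hW₀K⟩ : Subrepresentation ((rightTranslation (quasiSplit (↥(maximalRealSubfield L)) L (IsCMField.complexConj L) 3)).comp (archMaximalCompact L).subtype)))),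
      ∀ φ ∈ V, ∃ (Ec' : ℂ → (quasiSplit (↥(maximalRealSubfield L)) L (IsCMField.complexConj L) 3).Adelic → ℂ) (P : Set ℂ), IsClosed P ∧ (∀ z₀ : ℂ, ∀ᶠ s in 𝓝[≠] z₀, s ∉ P) ∧ (∀ z ∈ P, z.re ≤ 2) ∧
        (∀ z : ℂ, 2 < z.re → Ec' z = eisensteinSeriesU (flatSectionU φ z)) ∧ (∀ g (z : ℂ), z ∉ P → AnalyticAt ℂ (fun z => Ec' z g) z) ∧
        (∀ z : ℂ, z ∉ P → Continuous (Ec' z)) ∧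
        (∀ z₁ : ℂ, z₁ ∉ P → ∀ K : Set (quasiSplit (↥(maximalRealSubfield L)) L (IsCMField.complexConj L) 3).Adelic, IsCompact K → ∃ V ∈ 𝓝 z₁, ∃ M : ℝ, ∀ z ∈ V, ∀ g ∈ K, ‖Ec' z g‖ ≤ M) := by
  classical
  intro U₀ hU₀ V hVfd hVK hVχ hVc hVM hVlev hVirr _ φ hφ
  haveI := hVfd
  obtain ⟨hV, hirrV⟩ := hVirr
  -- the internal `W`-isotypy of the `K_max`-irreducible block (★ FILE A §A1), now keeping `W₀ ≤ V`
  obtain ⟨W₀, hW₀K, hW₀V, hW₀fd, hirr₀, hVτ⟩ := exists_isotypy_of_kMax_irreducible L V hV hirrV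
  haveI := hW₀fd
  -- the archimedean left law (★ FILE A §A2) and the `GL₃(𝔸_f)`-level (★ FILE A §A3)
  obtain ⟨cB, hVB, hcBz, hcB0⟩ := exists_archBorelLaw L (V := V) hVχ
  obtain ⟨U₀', hU₀o, hU₀c, hU₀K, hsub⟩ := exists_GLlevel_of_isTauLevel L hU₀
  have hVU := hVU_of_le_tauLevel L hVlev hsub
  -- the co-weight line for this `τ₀` (members of `W₀ ≤ V` are continuous pair-sections), in the ports' spelling
  obtain ⟨l₀, hl₀⟩ := hCO W₀ hW₀K hW₀fd (fun ψ hψ => hVχ ψ (hW₀V hψ)) (fun ψ hψ => hVc ψ (hW₀V hψ)) hirr₀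
  have hco : ∃ l₀ : ↥W₀ →ₗ[ℂ] ℂ, ∀ l : ↥W₀ →ₗ[ℂ] ℂ,
      (∀ m ∈ (borelAdelic (↥(maximalRealSubfield L)) L (IsCMField.complexConj L) 3).comap (archToAdelic (↥(maximalRealSubfield L)) L (IsCMField.complexConj L) 3 ((StdForm.antidiagonal 3).over L)), m ∈ (((standardMaximalCompactGL 3 L).comap (adelicVal (↥(maximalRealSubfield L)) L (IsCMField.complexConj L) 3 ((StdForm.antidiagonal 3).over L)) : Subgroup (quasiSplit (↥(maximalRealSubfield L)) L (IsCMField.complexConj L) 3).Adelic)).comap (archToAdelic (↥(maximalRealSubfield L)) L (IsCMField.complexConj L) 3 ((StdForm.antidiagonal 3).over L)) →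
        ∀ w, l ((fun a : ↥(arch (↥(maximalRealSubfield L)) L (IsCMField.complexConj L) 3 ((StdForm.antidiagonal 3).over L)) => if h : (adelicVal (↥(maximalRealSubfield L)) L (IsCMField.complexConj L) 3 ((StdForm.antidiagonal 3).over L)) ((archToAdelic (↥(maximalRealSubfield L)) L (IsCMField.complexConj L) 3 ((StdForm.antidiagonal 3).over L)) a) ∈ standardMaximalCompactGL 3 L then (Subrepresentation.toRepresentation (⟨W₀, hW₀K⟩ : Subrepresentation ((rightTranslation (quasiSplit (↥(maximalRealSubfield L)) L (IsCMField.complexConj L) 3)).comp (archMaximalCompact L).subtype))) ⟨(archToAdelic (↥(maximalRealSubfield L)) L (IsCMField.complexConj L) 3 ((StdForm.antidiagonal 3).over L)) a, archToAdelic_mem_archMaximalCompact L a h⟩ else LinearMap.id) m w) = cB 0 m * l w) →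
      ∃ a : ℂ, l = a • l₀ := by
    refine ⟨l₀, fun l hl => hl₀ l fun m hmB hmK w => ?_⟩
    have h := hl m hmB hmK w
    dsimp only at h
    rwa [dif_pos hmK, hcB0 m hmB hmK] at h
  -- the K-finite exports head with both τ-ports, projected to the seven exports clauses
  obtain ⟨n, φ', q, Ec, qc, P, -, -, -, -, -, -, -, -, hE2, -, hPc, hPcd, hPre, hEan, -, -, -, hE4, hEbd⟩ :=
    chiEisenstein_meromorphic_exports_kfinite_of_ports_of_coweightLine L (μ := μ) (νG := νG) (ν := ν) h𝓕N h𝓕c h𝓕₀ hβ hμZ μa μf ξ.hψ V hVK hVχ hVc hVM U₀' hU₀o hU₀c hU₀K hVU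
      (fun a : ↥(arch (↥(maximalRealSubfield L)) L (IsCMField.complexConj L) 3 ((StdForm.antidiagonal 3).over L)) => if h : (adelicVal (↥(maximalRealSubfield L)) L (IsCMField.complexConj L) 3 ((StdForm.antidiagonal 3).over L)) ((archToAdelic (↥(maximalRealSubfield L)) L (IsCMField.complexConj L) 3 ((StdForm.antidiagonal 3).over L)) a) ∈ standardMaximalCompactGL 3 L then (Subrepresentation.toRepresentation (⟨W₀, hW₀K⟩ : Subrepresentation ((rightTranslation (quasiSplit (↥(maximalRealSubfield L)) L (IsCMField.complexConj L) 3)).comp (archMaximalCompact L).subtype))) ⟨(archToAdelic (↥(maximalRealSubfield L)) L (IsCMField.complexConj L) 3 ((StdForm.antidiagonal 3).over L)) a, archToAdelic_mem_archMaximalCompact L a h⟩ else LinearMap.id)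
      cB hVB hVτ (cB 0) hcBz hco hφ
  exact ⟨Ec, P, hPc, hPcd, hPre, hE2, hEan, hE4, hEbd⟩

include μ h𝓕N h𝓕c h𝓕₀ hβ hμZ μa μf in
/-- **§4.2 — `exportsTauRow_closed'`** (ED. 2 of §2): ★ p864446's `hTEXP` ∀-row from `hμu`, the frame and the RESTRICTED letter `hCO′`. [cite: MoeglinWaldspurger1995, II.1.5, IV.1.9–IV.1.11]
[cite: BernsteinLapid2019, Thm 2.3, §4] -/
theorem exportsTauRow_closed' (hμu : μω.IsUnitary)
    (hCO : ∀ (W₀ : Submodule ℂ ((quasiSplit (↥(maximalRealSubfield L)) L (IsCMField.complexConj L) 3).Adelic → ℂ)) (hW₀K : ∀ k : ↥(archMaximalCompact L), ∀ ψ ∈ W₀, ((rightTranslation (quasiSplit (↥(maximalRealSubfield L)) L (IsCMField.complexConj L) 3)).comp (archMaximalCompact L).subtype) k ψ ∈ W₀) (_ : FiniteDimensional ℂ ↥W₀)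
      (_ : ∀ ψ ∈ W₀, IsChiSectionPair (ξ.bcη⁻¹ * ξ.bcψ⁻¹ * μω) ξ.ψ ψ) (_ : ∀ ψ ∈ W₀, Continuous ψ) (_ : (Subrepresentation.toRepresentation (⟨W₀, hW₀K⟩ : Subrepresentation ((rightTranslation (quasiSplit (↥(maximalRealSubfield L)) L (IsCMField.complexConj L) 3)).comp (archMaximalCompact L).subtype))).IsIrreducible),
      ∃ l₀ : ↥W₀ →ₗ[ℂ] ℂ, ∀ l : ↥W₀ →ₗ[ℂ] ℂ,
        (∀ (m : ↥(arch (↥(maximalRealSubfield L)) L (IsCMField.complexConj L) 3 ((StdForm.antidiagonal 3).over L))) (hmB : (archToAdelic (↥(maximalRealSubfield L)) L (IsCMField.complexConj L) 3 ((StdForm.antidiagonal 3).over L)) m ∈ borelAdelic (↥(maximalRealSubfield L)) L (IsCMField.complexConj L) 3) (hmK : (adelicVal (↥(maximalRealSubfield L)) L (IsCMField.complexConj L) 3 ((StdForm.antidiagonal 3).over L)) ((archToAdelic (↥(maximalRealSubfield L)) L (IsCMField.complexConj L) 3 ((StdForm.antidiagonal 3).over L)) m) ∈ standardMaximalCompactGL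 3 L) (w : ↥W₀),
          l ((Subrepresentation.toRepresentation (⟨W₀, hW₀K⟩ : Subrepresentation ((rightTranslation (quasiSplit (↥(maximalRealSubfield L)) L (IsCMField.complexConj L) 3)).comp (archMaximalCompact L).subtype))) ⟨(archToAdelic (↥(maximalRealSubfield L)) L (IsCMField.complexConj L) 3 ((StdForm.antidiagonal 3).over L)) m, archToAdelic_mem_archMaximalCompact L m hmK⟩ w) = ((((ξ.bcη⁻¹ * ξ.bcψ⁻¹ * μω)) (firstEntryUnit hmB) : ℂˣ) : ℂ) * (((ξ.ψ) (middleEntryUnitary hmB) : ℂˣ) : ℂ) * l w) →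
        ∃ a : ℂ, l = a • l₀) :
    ∀ (U₀ : Subgroup ↥(finAdelic (↥(maximalRealSubfield L)) L (IsCMField.complexConj L) 3 ((StdForm.antidiagonal 3).over L))) (_ : IsTauLevel L U₀) (φ : (quasiSplit (↥(maximalRealSubfield L)) L (IsCMField.complexConj L) 3).Adelic → ℂ) (_ : φ ∈ chiSectionSpacePair (ξ.bcη⁻¹ * ξ.bcψ⁻¹ * μω) ξ.ψ (tauLevel L U₀) ((1 : ↥(tauLevel L U₀) →* ℂ) : ↥(tauLevel L U₀) → ℂ)) (_ : Continuous φ) (_ : IsArchFinite L φ),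
      ∃ (Ec' : ℂ → (quasiSplit (↥(maximalRealSubfield L)) L (IsCMField.complexConj L) 3).Adelic → ℂ) (P : Set ℂ), IsClosed P ∧ (∀ z₀ : ℂ, ∀ᶠ s in 𝓝[≠] z₀, s ∉ P) ∧ (∀ z ∈ P, z.re ≤ 2) ∧
        (∀ z : ℂ, 2 < z.re → Ec' z = eisensteinSeriesU (flatSectionU φ z)) ∧ (∀ g (z : ℂ), z ∉ P → AnalyticAt ℂ (fun z => Ec' z g) z) ∧
        (∀ z : ℂ, z ∉ P → Continuous (Ec' z)) ∧
        (∀ z₁ : ℂ, z₁ ∉ P → ∀ K : Set (quasiSplit (↥(maximalRealSubfield L)) L (IsCMField.complexConj L) 3).Adelic, IsCompact K → ∃ V ∈ 𝓝 z₁, ∃ M : ℝ, ∀ z ∈ V, ∀ g ∈ K, ‖Ec' z g‖ ≤ M) :=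
  exportsTauRow_of_pureBlocks L ξ μω (isUnitary_blockChar L ξ μω hμu (norm_eta_apply_eq_one L ξ) (norm_psi_apply_eq_one L ξ)) (norm_psi_apply_eq_one L ξ)
    (hSUM_of_unitary L ξ μω hμu (norm_eta_apply_eq_one L ξ) (norm_psi_apply_eq_one L ξ))
    (hPURE_of_coweightLines' L μ νG ν h𝓕N h𝓕c h𝓕₀ hβ hμZ μa μf ξ μω hCO)

include μ h𝓕N h𝓕c h𝓕₀ hβ hμZ μa μf in
/-- **§4.3 HEAD ED. 2 — `hEXP_tauRow_closed'`**: the `hEXP` binder of ★ p864188 `res_midBlock_le_residual_of_tauAdmissible` at the `φ_ξ`-block, BYTE FOR BYTE, from `hμu`, the frame and the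
RESTRICTED co-weight line letter **`hCO′`** (co-weight line for every irreducible finite-dimensional `K_∞`-stable `W₀` of CONTINUOUS PAIR-SECTIONS of the block — the letter J-S8-CO's steps
(2)–(5) discharge).  Binder list of record: (F) socket + exports frame, (F′) ports' Haar frame `μa μf`, (U) `hμu`, (L′) `hCO′`. [cite: MoeglinWaldspurger1995, IV.1.9–IV.1.11]
[cite: BernsteinLapid2019, Thm 2.3, §4] [cite: Rogawski1990, §13.9 (ii)] -/
theorem hEXP_tauRow_closed' (hμu : μω.IsUnitary)
    (hCO : ∀ (W₀ : Submodule ℂ ((quasiSplit (↥(maximalRealSubfield L)) L (IsCMField.complexConj L) 3).Adelic → ℂ)) (hW₀K : ∀ k : ↥(archMaximalCompact L), ∀ ψ ∈ W₀, ((rightTranslation (quasiSplit (↥(maximalRealSubfield L)) L (IsCMField.complexConj L) 3)).comp (archMaximalCompact L).subtype) k ψ ∈ W₀) (_ : FiniteDimensional ℂ ↥W₀)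
      (_ : ∀ ψ ∈ W₀, IsChiSectionPair (ξ.bcη⁻¹ * ξ.bcψ⁻¹ * μω) ξ.ψ ψ) (_ : ∀ ψ ∈ W₀, Continuous ψ) (_ : (Subrepresentation.toRepresentation (⟨W₀, hW₀K⟩ : Subrepresentation ((rightTranslation (quasiSplit (↥(maximalRealSubfield L)) L (IsCMField.complexConj L) 3)).comp (archMaximalCompact L).subtype))).IsIrreducible),
      ∃ l₀ : ↥W₀ →ₗ[ℂ] ℂ, ∀ l : ↥W₀ →ₗ[ℂ] ℂ,
        (∀ (m : ↥(arch (↥(maximalRealSubfield L)) L (IsCMField.complexConj L) 3 ((StdForm.antidiagonal 3).over L))) (hmB : (archToAdelic (↥(maximalRealSubfield L)) L (IsCMField.complexConj L) 3 ((StdForm.antidiagonal 3).over L)) m ∈ borelAdelic (↥(maximalRealSubfield L)) L (IsCMField.complexConj L) 3) (hmK : (adelicVal (↥(maximalRealSubfield L)) L (IsCMField.complexConj L) 3 ((StdForm.antidiagonal 3).over L)) ((archToAdelic (↥(maximalRealSubfield L)) L (IsCMField.complexConj L) 3 ((StdForm.antidiagonal 3).over L)) m) ∈ standardMaximalCompactGL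 3 L) (w : ↥W₀),
          l ((Subrepresentation.toRepresentation (⟨W₀, hW₀K⟩ : Subrepresentation ((rightTranslation (quasiSplit (↥(maximalRealSubfield L)) L (IsCMField.complexConj L) 3)).comp (archMaximalCompact L).subtype))) ⟨(archToAdelic (↥(maximalRealSubfield L)) L (IsCMField.complexConj L) 3 ((StdForm.antidiagonal 3).over L)) m, archToAdelic_mem_archMaximalCompact L m hmK⟩ w) = ((((ξ.bcη⁻¹ * ξ.bcψ⁻¹ * μω)) (firstEntryUnit hmB) : ℂˣ) : ℂ) * (((ξ.ψ) (middleEntryUnitary hmB) : ℂˣ) : ℂ) * l w) →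
        ∃ a : ℂ, l = a • l₀) :
    ∀ (U₀ : Subgroup ↥(finAdelic (↥(maximalRealSubfield L)) L (IsCMField.complexConj L) 3 ((StdForm.antidiagonal 3).over L))) (_ : IsTauLevel L U₀)
      (φ : (quasiSplit (↥(maximalRealSubfield L)) L (IsCMField.complexConj L) 3).Adelic → ℂ) (_ : φ ∈ chiSectionSpacePair (ξ.bcη⁻¹ * ξ.bcψ⁻¹ * μω) ξ.ψ (tauLevel L U₀) ((1 : ↥(tauLevel L U₀) →* ℂ) : ↥(tauLevel L U₀) → ℂ)) (_ : Continuous φ)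
      (_ : IsArchFinite L φ)
      (Ec : ℂ → (quasiSplit (↥(maximalRealSubfield L)) L (IsCMField.complexConj L) 3).Adelic → ℂ) (Sp : Finset ℂ) (_ : ∀ s ∈ Sp, s.im = 0 ∧ 1 < s.re ∧ s.re ≤ 2)
      (_ : ∀ g, DifferentiableOn ℂ (fun z => Ec z g) ({z : ℂ | 1 < z.re} \ (↑Sp : Set ℂ)))
      (_ : ∀ z : ℂ, 2 < z.re → Ec z = eisensteinSeriesU (flatSectionU φ z))
      (Fp : (quasiSplit (↥(maximalRealSubfield L)) L (IsCMField.complexConj L) 3).Adelic → ℂ → ℂ) (_ : ∀ g, AnalyticAt ℂ (Fp g) ((3 : ℂ) / 2))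
      (_ : ∀ g, Fp g =ᶠ[𝓝[≠] ((3 : ℂ) / 2)] fun z => (z - (3 : ℂ) / 2) * Ec z g)
      (f : (quasiSplit (↥(maximalRealSubfield L)) L (IsCMField.complexConj L) 3).L2 μ) (_ : (f : (quasiSplit (↥(maximalRealSubfield L)) L (IsCMField.complexConj L) 3).automorphicQuotient → ℂ) =ᵐ[μ] fun x => Fp (Quotient.out (x : (quasiSplit (↥(maximalRealSubfield L)) L (IsCMField.complexConj L) 3).Adelic ⧸ (quasiSplit (↥(maximalRealSubfield L)) L (IsCMField.complexConj L) 3).quotientSubgroup))⁻¹ ((3 : ℂ) / 2)), (∀ z ∈ ({z : ℂ | 1 < z.re} \ (↑Sp : Set ℂ)), Continuous (Ec z)) ∧ (∀ z₁ ∈ ({z : ℂ | 1 < z.re} \ (↑Sp : Set ℂ)), ∀ K : Set (quasiSplit (↥(maximalRealSubfield L)) L (IsCMField.complexConj L) 3).Adelic, IsCompact K → ∃ V ∈ 𝓝 z₁, ∃ M : ℝ, ∀ z ∈ V, ∀ g ∈ K, ‖Ec z g‖ ≤ M)  :=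
  hEXP_tauRow_of_exportsRow L μ (exportsTauRow_closed' L μ νG ν h𝓕N h𝓕c h𝓕₀ hβ hμZ μa μf ξ μω hμu hCO)

end Summit.HodgeConjecture.HodgeConjecture.R90.S8

end
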